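import Summits.ResolutionOfSingularities.ResolutionOfSingularities.Theorems.FrobeniusLadderFInjectiveMacaulayficationS2ModificationAffineLocalization
import Summits.ResolutionOfSingularities.ResolutionOfSingularities.Theorems.FrobeniusLadderFInjectiveMacaulayficationS2ModificationAffineLocal
import Literature.AlgebraicGeometry.Resolution.NormalizationOfVarietiesProofs
import Mathlib.AlgebraicGeometry.AffineScheme
import Mathlib.AlgebraicGeometry.Morphisms.Finite
import Mathlib.AlgebraicGeometry.Noetherian
import HarnessLib

/-!
# The affine S₂-modification as a morphism of affine schemes `Spec A′ → Spec A`: finite, surjective, integral Noetherian source,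
# and a stalk isomorphism off `V(𝔟)` — file L5 of the `S2Modification` discharge
# (crux `FInjectiveMacaulayfication` stmt-ResolutionOfSingularities-15315, chain w45a, hole #3γ/FC″, rung r2 input S-S2
# `FCForallExistsDimLe2.S2Modification`; sequel to `…S2ModificationAffineLocalization` p552011 (L2, this seat) and
# `…S2ModificationAffineLocal` p551120 (L3a, res-L1-w45a-stub-3: `locSub` = `A′_P ⊆ K`); res-L1-w45a-plan-1 R13.46 «stub-2 := L1–L3 + L5»;
# memo `D/res-D-pv-019/S2MOD-MEMO.md` §2 (a) / §3 L5; seat res-L1-w45a-stub-2)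

[OURS · L1 W4.5a] Support file (`--supports stmt-ResolutionOfSingularities-15315 --as helper`); NOT a statement of any manuscript; no named
fact; no definitions; AI-written (AI review is weaker than expert review).

SETTING. `A` a domain with fraction field `K`, `s ⊆ A ∖ {0}` finite, `A′ = s2Mod A K s hs = Ā ∩ ⋂_{f ∈ s} A[1/f]`, `φ : A → A′` the
structure map, `g := Spec φ : X₃ = Spec A′ → X₂ = Spec A`. For a prime `𝔓` of `A′` with `𝔭 := φ⁻¹𝔓 ∉ V(s)` (some `f ∈ s` has
`φ f ∉ 𝔓`):

* `mem_locSub_iff_of_not_mem` — **`A′_𝔓 = A_𝔭` inside `K`**: `x ∈ locSub 𝔓 ↔ x = a/m` with `m ∉ 𝔭` (L2's `exists_mul_mem_iff_mem_range`: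
  `A′ ⊆ A_𝔭`; and an element of `A′ ∖ 𝔓` is a unit of the local ring `A_𝔭`, because `𝔭A_𝔭 ∩ A′ ⊆ 𝔓`);
  `restrictScalars_locSub_eq_ofField` — the same as an equality of `A`-subalgebras of `K`;
* `isLocalization_atPrime_locSub` — hence `A′_𝔓 ⊆ K` is ALSO the localisation of `A` at `𝔭` (`IsLocalization.AtPrime`);
* `bijective_localRingHom` — **the induced local map `A_𝔭 → A′_𝔓` (`Localization.localRingHom`) is bijective** (both sides are
  `A`- resp. `A′`-isomorphic to `A′_𝔓 ⊆ K`, and `localRingHom` is the unique compatible map);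
* `isIso_stalkMap_of_not_mem` — **scheme form: `IsIso (g.stalkMap x₃)` for every point `x₃` of `Spec A′` whose image is off
  `V(s)`** (Mathlib's `Scheme.localRingHom_comp_stalkIso`), i.e. the conjunct «`g` is an isomorphism on stalks off `F`» of
  `FCForallExistsDimLe2.S2Modification` for an affine chart; `isIso_stalkMap_of_not_mem_zeroLocus` — the same with the hypothesis
  spelled `g x₃ ∉ zeroLocus s`.

And the remaining scheme-level conjuncts of `S2Modification` for the affine chart (§4): `isIntegral_Spec` (`X₃` integral),
`isNoetherian_Spec` / `isFinite_SpecMap` (given `Ā` finite over `A`; discharged for `A` of finite type over a field `k` by E. Noether's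
theorem `NoetherFiniteIntegralClosure_holds` in `isNoetherian_Spec_of_finiteType` / `isFinite_SpecMap_of_finiteType`), and
`surjective_SpecMap` (lying over for the integral extension `A ⊆ A′`). What is NOT here: the two clauses OVER `V(𝔟)` (Cohen–Macaulay,
and integrally closed in dimension `≤ 1`) — files L3a ✓/L3b of res-L1-w45a-stub-3 on `Localization.AtPrime A′ P` — and the gluing of the
affine pieces (L4, res-L1-w45a-stub-7).

[folklore] [cite: EGAIV2, 5.10.16–17]
-/

-- single-problem summit: the doubled namespace component is forced
set_option linter.dupNamespace false

noncomputable section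

namespace Summit.ResolutionOfSingularities.ResolutionOfSingularities.Theorems.FInjectiveMacaulayfication.S2ModificationAffineSpec

open Summit.ResolutionOfSingularities.ResolutionOfSingularities.Theorems.FInjectiveMacaulayfication
open S2ModificationAffine S2ModificationAffineRadical S2ModificationAffineLocalization S2ModificationAffineLocal
open AlgebraicGeometry CategoryTheory nonZeroDivisors

variable (A : Type) [CommRing A] [IsDomain A] (K : Type) [Field K] [Algebra A K] [IsFractionRing A K]
variable (s : Finset A) (hs : ∀ f ∈ s, f ≠ 0)

/-! ## §1 `M⁻¹A ⊆ K` (Mathlib's `Localization.subalgebra.ofField`): membership -/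

omit [IsDomain A] in
/-- Membership in `M⁻¹A ⊆ K`: `x = a · m⁻¹` with `m ∈ M`. [folklore] -/
theorem mem_ofField_iff (M : Submonoid A) (hM : M ≤ A⁰) (x : K) :
    x ∈ Localization.subalgebra.ofField K M hM ↔ ∃ (a m : A), m ∈ M ∧ x = algebraMap A K a * (algebraMap A K m)⁻¹ := by
  unfold Localization.subalgebra.ofField
  rw [← SetLike.mem_coe, Subalgebra.coe_copy]
  simp only [Set.mem_setOf_eq]
  constructor
  · rintro ⟨a, m, hm, rfl⟩
    exact ⟨a, m, hm, rfl⟩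
  · rintro ⟨a, m, hm, rfl⟩
    exact ⟨a, m, hm, rfl⟩

/-! ## §2 `A′_𝔓 = A_𝔭` inside `K` for `𝔭 = φ⁻¹𝔓 ∉ V(s)` -/

/-- **An element of `A′ ∖ 𝔓` is `a/m` with `a, m ∉ 𝔭`** (`𝔭 = φ⁻¹𝔓`, `𝔓 ⊉ φ(s)`): `A′ ⊆ A_𝔭` inside `K` (L2), and if `t = a/m` with
`a ∈ 𝔭` then `φ(m)·t = φ(a) ∈ 𝔓` with `φ(m) ∉ 𝔓`, forcing `t ∈ 𝔓`. [folklore] -/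
theorem exists_eq_div_of_not_mem (𝔓 : Ideal (s2Mod A K s hs)) [𝔓.IsPrime]
    (h𝔓 : ∃ f ∈ s, algebraMap A (s2Mod A K s hs) f ∉ 𝔓) (t : s2Mod A K s hs) (ht : t ∉ 𝔓) :
    ∃ (a m : A), a ∉ 𝔓.comap (algebraMap A (s2Mod A K s hs)) ∧ m ∉ 𝔓.comap (algebraMap A (s2Mod A K s hs)) ∧
      (t : K) = algebraMap A K a * (algebraMap A K m)⁻¹ := by
  set 𝔭 := 𝔓.comap (algebraMap A (s2Mod A K s hs)) with h𝔭
  have hsM : ∃ f ∈ s, f ∈ 𝔭.primeCompl := h𝔓.imp fun f hf => ⟨hf.1, hf.2⟩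
  -- `t ∈ A′ ⊆ A_𝔭 = M⁻¹A ⊆ K`
  have ht' : (t : K) ∈ Set.range (algebraMap (Localization.subalgebra.ofField K 𝔭.primeCompl 𝔭.primeCompl_le_nonZeroDivisors) K) :=
    (exists_mul_mem_iff_mem_range A K (Localization.subalgebra.ofField K 𝔭.primeCompl 𝔭.primeCompl_le_nonZeroDivisors)
      𝔭.primeCompl s hs hsM (t : K)).mp ⟨1, one_mem _, by rw [map_one, one_mul]; exact t.2⟩
  obtain ⟨⟨y, hy⟩, hyt⟩ := ht'
  obtain ⟨a, m, hm, rfl⟩ := (mem_ofField_iff A K 𝔭.primeCompl 𝔭.primeCompl_le_nonZeroDivisors y).mp hy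
  change algebraMap A K a * (algebraMap A K m)⁻¹ = (t : K) at hyt
  refine ⟨a, m, fun ha => ht ?_, hm, hyt.symm⟩
  -- `φ m · t = φ a ∈ 𝔓`
  have hmt : algebraMap A (s2Mod A K s hs) m * t = algebraMap A (s2Mod A K s hs) a := by
    apply Subtype.ext
    change ((algebraMap A (s2Mod A K s hs) m : s2Mod A K s hs) : K) * (t : K) = ((algebraMap A (s2Mod A K s hs) a : _) : K)
    rw [Subalgebra.coe_algebraMap, Subalgebra.coe_algebraMap, ← hyt, mul_comm, mul_assoc,
      inv_mul_cancel₀ (algebraMap_ne_zero A K (nonZeroDivisors.ne_zero (𝔭.primeCompl_le_nonZeroDivisors hm))), mul_one]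
  have hmem : algebraMap A (s2Mod A K s hs) m * t ∈ 𝔓 := by rw [hmt]; exact ha
  exact ((Ideal.IsPrime.mem_or_mem inferInstance hmem).resolve_left hm)

/-- **`A′_𝔓 = A_𝔭` inside `K`** (`𝔭 = φ⁻¹𝔓 ∉ V(s)`): `x ∈ A′_𝔓 = locSub 𝔓` iff `x = a/m` with `m ∉ 𝔭`. [folklore] -/
theorem mem_locSub_iff_of_not_mem (𝔓 : Ideal (s2Mod A K s hs)) [𝔓.IsPrime]
    (h𝔓 : ∃ f ∈ s, algebraMap A (s2Mod A K s hs) f ∉ 𝔓) (x : K) :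
    x ∈ locSub A K s hs 𝔓 ↔
      ∃ (a m : A), m ∉ 𝔓.comap (algebraMap A (s2Mod A K s hs)) ∧ x = algebraMap A K a * (algebraMap A K m)⁻¹ := by
  set 𝔭 := 𝔓.comap (algebraMap A (s2Mod A K s hs)) with h𝔭
  have hsM : ∃ f ∈ s, f ∈ 𝔭.primeCompl := h𝔓.imp fun f hf => ⟨hf.1, hf.2⟩
  rw [mem_locSub_iff']
  constructor
  · rintro ⟨t, ht, htx⟩
    -- `t·x = y ∈ A′ ⊆ A_𝔭` and `t⁻¹ ∈ A_𝔭`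
    obtain ⟨⟨y, hy⟩, hyt⟩ := (exists_mul_mem_iff_mem_range A K
      (Localization.subalgebra.ofField K 𝔭.primeCompl 𝔭.primeCompl_le_nonZeroDivisors) 𝔭.primeCompl s hs hsM ((t : K) * x)).mp
      ⟨1, one_mem _, by rw [map_one, one_mul]; exact htx⟩
    obtain ⟨a₁, m₁, hm₁, rfl⟩ := (mem_ofField_iff A K 𝔭.primeCompl 𝔭.primeCompl_le_nonZeroDivisors y).mp hy
    change algebraMap A K a₁ * (algebraMap A K m₁)⁻¹ = (t : K) * x at hyt
    obtain ⟨a₂, m₂, ha₂, hm₂, ht₂⟩ := exists_eq_div_of_not_mem A K s hs 𝔓 h𝔓 t ht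
    have ha₂0 : algebraMap A K a₂ ≠ 0 := algebraMap_ne_zero A K (fun h => ha₂ (by rw [h]; exact Ideal.zero_mem _))
    have hm₂0 : algebraMap A K m₂ ≠ 0 := algebraMap_ne_zero A K (fun h => hm₂ (by rw [h]; exact Ideal.zero_mem _))
    have ht0 : (t : K) ≠ 0 := by rw [ht₂]; exact mul_ne_zero ha₂0 (inv_ne_zero hm₂0)
    refine ⟨a₁ * m₂, m₁ * a₂, fun h => (Ideal.IsPrime.mem_or_mem inferInstance h).elim hm₁ ha₂, ?_⟩
    -- `x = t⁻¹ · (a₁/m₁) = (m₂/a₂)·(a₁/m₁)`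
    have hx : x = ((t : K))⁻¹ * (algebraMap A K a₁ * (algebraMap A K m₁)⁻¹) := by
      rw [hyt, ← mul_assoc, inv_mul_cancel₀ ht0, one_mul]
    rw [hx, ht₂, map_mul, map_mul, mul_inv, mul_inv, inv_inv]
    ring
  · rintro ⟨a, m, hm, rfl⟩
    refine ⟨algebraMap A (s2Mod A K s hs) m, hm, ?_⟩
    rw [Subalgebra.coe_algebraMap, mul_comm, mul_assoc,
      inv_mul_cancel₀ (algebraMap_ne_zero A K (fun h => hm (by rw [h]; exact Ideal.zero_mem _))), mul_one]
    exact algebraMap_mem_s2Mod A K s hs a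

/-- **`A′_𝔓 = A_𝔭` as `A`-subalgebras of `K`** (`𝔭 = φ⁻¹𝔓 ∉ V(s)`; `A_𝔭 ⊆ K` is Mathlib's `Localization.subalgebra.ofField`).
[folklore] -/
theorem restrictScalars_locSub_eq_ofField (𝔓 : Ideal (s2Mod A K s hs)) [𝔓.IsPrime]
    (h𝔓 : ∃ f ∈ s, algebraMap A (s2Mod A K s hs) f ∉ 𝔓) :
    (locSub A K s hs 𝔓).restrictScalars A =
      Localization.subalgebra.ofField K (𝔓.comap (algebraMap A (s2Mod A K s hs))).primeCompl
        (Ideal.primeCompl_le_nonZeroDivisors _) := by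
  ext x
  rw [Subalgebra.mem_restrictScalars, mem_locSub_iff_of_not_mem A K s hs 𝔓 h𝔓, mem_ofField_iff]
  exact ⟨fun ⟨a, m, hm, hx⟩ => ⟨a, m, hm, hx⟩, fun ⟨a, m, hm, hx⟩ => ⟨a, m, hm, hx⟩⟩

/-- **`A′_𝔓 ⊆ K` is the localisation of `A` at `𝔭 = φ⁻¹𝔓`** when `𝔭 ∉ V(s)` (as an `A`-algebra through `A → A′ → A′_𝔓`).
[folklore] -/
theorem isLocalization_atPrime_locSub (𝔓 : Ideal (s2Mod A K s hs)) [𝔓.IsPrime]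
    (h𝔓 : ∃ f ∈ s, algebraMap A (s2Mod A K s hs) f ∉ 𝔓) :
    IsLocalization.AtPrime (locSub A K s hs 𝔓) (𝔓.comap (algebraMap A (s2Mod A K s hs))) := by
  set 𝔭 := 𝔓.comap (algebraMap A (s2Mod A K s hs)) with h𝔭
  have hAK : ∀ a : A, ((algebraMap A (locSub A K s hs 𝔓) a : locSub A K s hs 𝔓) : K) = algebraMap A K a := fun a => rfl
  refine ⟨?_, ?_, ?_⟩
  · rintro ⟨m, hm⟩
    have hφm : algebraMap A (s2Mod A K s hs) m ∈ 𝔓.primeCompl := hm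
    have := IsLocalization.map_units (locSub A K s hs 𝔓) (⟨_, hφm⟩ : 𝔓.primeCompl)
    rwa [← IsScalarTower.algebraMap_apply] at this
  · intro z
    obtain ⟨a, m, hm, hz⟩ := (mem_locSub_iff_of_not_mem A K s hs 𝔓 h𝔓 (z : K)).mp z.2
    refine ⟨⟨a, ⟨m, hm⟩⟩, Subtype.ext ?_⟩
    change (z : K) * ((algebraMap A (locSub A K s hs 𝔓) m : locSub A K s hs 𝔓) : K)
      = ((algebraMap A (locSub A K s hs 𝔓) a : locSub A K s hs 𝔓) : K)
    rw [hAK, hAK, hz, mul_assoc,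
      inv_mul_cancel₀ (algebraMap_ne_zero A K (fun h => hm (by rw [h]; exact Ideal.zero_mem _))), mul_one]
  · intro a₁ a₂ h
    refine ⟨1, ?_⟩
    have h' := congrArg (fun w : locSub A K s hs 𝔓 => (w : K)) h
    simp only [hAK] at h'
    rw [IsFractionRing.injective A K h']

/-! ## §3 The induced local map `A_𝔭 → A′_𝔓` is bijective; the stalk map of `Spec A′ → Spec A` is an isomorphism off `V(s)` -/

/-- **`Localization.localRingHom 𝔭 𝔓 φ : A_𝔭 → A′_𝔓` is bijective for `𝔭 = φ⁻¹𝔓 ∉ V(s)`**: `A_𝔭 ≅ A′_𝔓 ⊆ K` as `A`-algebras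
(`isLocalization_atPrime_locSub`) and `A′_𝔓 ≅ (A′_𝔓 ⊆ K)` as `A′`-algebras (`S2ModificationAffineLocal.isLocalization_locSub`), and
`localRingHom` is the unique map compatible with `φ` (`Localization.localRingHom_unique`). [folklore] -/
theorem bijective_localRingHom (𝔓 : Ideal (s2Mod A K s hs)) [𝔓.IsPrime]
    (h𝔓 : ∃ f ∈ s, algebraMap A (s2Mod A K s hs) f ∉ 𝔓) :
    Function.Bijective (Localization.localRingHom (𝔓.comap (algebraMap A (s2Mod A K s hs))) 𝔓
      (algebraMap A (s2Mod A K s hs)) rfl) := by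
  set 𝔭 := 𝔓.comap (algebraMap A (s2Mod A K s hs)) with h𝔭
  haveI := isLocalization_atPrime_locSub A K s hs 𝔓 h𝔓
  -- the two identifications with `A′_𝔓 ⊆ K`
  let e₁ : Localization.AtPrime 𝔭 ≃ₐ[A] locSub A K s hs 𝔓 :=
    IsLocalization.algEquiv 𝔭.primeCompl (Localization.AtPrime 𝔭) (locSub A K s hs 𝔓)
  let e₂ : Localization.AtPrime 𝔓 ≃ₐ[s2Mod A K s hs] locSub A K s hs 𝔓 :=
    IsLocalization.algEquiv 𝔓.primeCompl (Localization.AtPrime 𝔓) (locSub A K s hs 𝔓)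
  let e : Localization.AtPrime 𝔭 ≃+* Localization.AtPrime 𝔓 := e₁.toRingEquiv.trans e₂.toRingEquiv.symm
  have he : Localization.localRingHom 𝔭 𝔓 (algebraMap A (s2Mod A K s hs)) rfl = e.toRingHom := by
    refine Localization.localRingHom_unique _ _ _ _ fun a => ?_
    change e₂.symm (e₁ (algebraMap A (Localization.AtPrime 𝔭) a)) = _
    rw [e₁.commutes, IsScalarTower.algebraMap_apply A (s2Mod A K s hs) (locSub A K s hs 𝔓), e₂.symm.commutes]
  rw [he]
  exact e.bijective

/-- **`Spec A′ → Spec A` is an isomorphism on stalks off `V(s)`**: for a point `x₃` of `Spec A′` whose image `𝔭 = φ⁻¹x₃` misses some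
`f ∈ s`, the stalk map `𝒪_{Spec A, 𝔭} → 𝒪_{Spec A′, x₃}` of `g = Spec φ` is an isomorphism (memo §2 (a): «`g` is an isomorphism off
`F`»; under `Spec.stalkIso` it is `Localization.localRingHom`, bijective by `bijective_localRingHom`). [folklore] [cite: EGAIV2, 5.10.16–17] -/
theorem isIso_stalkMap_of_not_mem (x : PrimeSpectrum (s2Mod A K s hs))
    (hx : ∃ f ∈ s, algebraMap A (s2Mod A K s hs) f ∉ x.asIdeal) :
    IsIso ((Spec.map (CommRingCat.ofHom (algebraMap A (s2Mod A K s hs)))).stalkMap x) := by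
  refine ((MorphismProperty.isomorphisms CommRingCat).arrow_mk_iso_iff
    (Scheme.arrowStalkMapSpecIso (CommRingCat.ofHom (algebraMap A (s2Mod A K s hs))) x)).mpr ?_
  exact (ConcreteCategory.isIso_iff_bijective _).mpr (bijective_localRingHom A K s hs x.asIdeal hx)

/-- The same with the hypothesis spelled on the base: **if `g x₃ ∉ V(s)` then `IsIso (g.stalkMap x₃)`** (`g = Spec φ : Spec A′ → Spec A`,
`V(s) = PrimeSpectrum.zeroLocus s`) — the «stalk isomorphism off `F`» conjunct of `FCForallExistsDimLe2.S2Modification` on an affine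
chart with `F ∩ Spec A = V(s)`. [folklore] -/
theorem isIso_stalkMap_of_not_mem_zeroLocus (x : PrimeSpectrum (s2Mod A K s hs))
    (hx : (Spec.map (CommRingCat.ofHom (algebraMap A (s2Mod A K s hs)))).base x ∉ PrimeSpectrum.zeroLocus (s : Set A)) :
    IsIso ((Spec.map (CommRingCat.ofHom (algebraMap A (s2Mod A K s hs)))).stalkMap x) := by
  refine isIso_stalkMap_of_not_mem A K s hs x ?_
  have hx' : ¬ ((s : Set A) ⊆ (PrimeSpectrum.comap (algebraMap A (s2Mod A K s hs)) x).asIdeal) :=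
    fun h => hx ((PrimeSpectrum.mem_zeroLocus _ _).mpr h)
  obtain ⟨f, hf, hfx⟩ := Set.not_subset.mp hx'
  exact ⟨f, hf, hfx⟩

/-! ## §4 The other scheme-level conjuncts on an affine chart: integral, Noetherian, finite, surjective -/

/-- **`X₃ = Spec A′` is an integral scheme** (`A′ ⊆ K` is a domain). [folklore] -/
theorem isIntegral_Spec : IsIntegral (Spec (CommRingCat.of (s2Mod A K s hs))) :=
  inferInstance

/-- `A′` is a finite `A`-module when `Ā` is (`A` Noetherian; file 1 `s2Mod_fg`). [folklore] -/
theorem module_finite_s2Mod [IsNoetherianRing A] (hfin : (Subalgebra.toSubmodule (integralClosure A K)).FG) :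
    Module.Finite A (s2Mod A K s hs) :=
  Module.Finite.of_fg (s2Mod_fg A K s hs hfin)

/-- **`X₃ = Spec A′` is Noetherian** when `Ā` is finite over the Noetherian ring `A`. [folklore] -/
theorem isNoetherian_Spec [IsNoetherianRing A] (hfin : (Subalgebra.toSubmodule (integralClosure A K)).FG) :
    IsNoetherian (Spec (CommRingCat.of (s2Mod A K s hs))) := by
  haveI : IsNoetherianRing (s2Mod A K s hs) := isNoetherianRing_s2Mod A K s hs hfin
  infer_instance

/-- **`g : Spec A′ → Spec A` is finite** when `Ā` is finite over the Noetherian ring `A`. [folklore] -/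
theorem isFinite_SpecMap [IsNoetherianRing A] (hfin : (Subalgebra.toSubmodule (integralClosure A K)).FG) :
    IsFinite (Spec.map (CommRingCat.ofHom (algebraMap A (s2Mod A K s hs)))) := by
  rw [IsFinite.SpecMap_iff]
  haveI : Module.Finite A (s2Mod A K s hs) := module_finite_s2Mod A K s hs hfin
  exact RingHom.finite_algebraMap.mpr this

/-- `A → A′` is injective (both embed in `K`). [folklore] -/
theorem faithfulSMul_s2Mod : FaithfulSMul A (s2Mod A K s hs) :=
  (faithfulSMul_iff_algebraMap_injective A (s2Mod A K s hs)).mpr fun a b h =>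
    IsFractionRing.injective A K (by
      have h' := congrArg (fun y : s2Mod A K s hs => (y : K)) h
      simpa only [Subalgebra.coe_algebraMap] using h')

/-- **`g : Spec A′ → Spec A` is surjective** (lying over for the integral extension `A ⊆ A′`). [folklore] -/
theorem surjective_SpecMap :
    Function.Surjective (Spec.map (CommRingCat.ofHom (algebraMap A (s2Mod A K s hs)))).base := by
  haveI := isIntegral_s2Mod A K s hs
  haveI := faithfulSMul_s2Mod A K s hs
  exact Algebra.IsIntegral.comap_surjective A (s2Mod A K s hs)

/-! ### Discharging «`Ā` finite over `A`» for `A` of finite type over a field (E. Noether) -/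

/-- For `A` a domain of finite type over a field `k`, `Ā` is a finite `A`-module (`NoetherFiniteIntegralClosure_holds`), in the `FG` form
file 1 consumes. [cite: Liu2002, Cor. 4.1.30, p. 122] -/
theorem integralClosure_fg_of_finiteType (k : Type) [Field k] [Algebra k A] [Algebra.FiniteType k A] :
    (Subalgebra.toSubmodule (integralClosure A K)).FG := by
  haveI : Module.Finite A (integralClosure A K) :=
    Literature.AlgebraicGeometry.Resolution.NoetherFiniteIntegralClosure_holds.self k A K
  exact Module.Finite.iff_fg.mp this

/-- **`X₃ = Spec A′` is Noetherian** for `A` a domain of finite type over a field. [folklore] -/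
theorem isNoetherian_Spec_of_finiteType (k : Type) [Field k] [Algebra k A] [Algebra.FiniteType k A] :
    IsNoetherian (Spec (CommRingCat.of (s2Mod A K s hs))) := by
  haveI : IsNoetherianRing A := Algebra.FiniteType.isNoetherianRing k A
  exact isNoetherian_Spec A K s hs (integralClosure_fg_of_finiteType A K k)

/-- **`g : Spec A′ → Spec A` is finite** for `A` a domain of finite type over a field. [folklore] -/
theorem isFinite_SpecMap_of_finiteType (k : Type) [Field k] [Algebra k A] [Algebra.FiniteType k A] :
    IsFinite (Spec.map (CommRingCat.ofHom (algebraMap A (s2Mod A K s hs)))) := by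
  haveI : IsNoetherianRing A := Algebra.FiniteType.isNoetherianRing k A
  exact isFinite_SpecMap A K s hs (integralClosure_fg_of_finiteType A K k)

/-- `A′` is a finite `A`-module for `A` a domain of finite type over a field (so `A′` is of finite type over `k` as well, by
`Algebra.FiniteType.trans` at the use site). [folklore] -/
theorem module_finite_s2Mod_of_finiteType (k : Type) [Field k] [Algebra k A] [Algebra.FiniteType k A] :
    Module.Finite A (s2Mod A K s hs) := by
  haveI : IsNoetherianRing A := Algebra.FiniteType.isNoetherianRing k A
  exact module_finite_s2Mod A K s hs (integralClosure_fg_of_finiteType A K k)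

end Summit.ResolutionOfSingularities.ResolutionOfSingularities.Theorems.FInjectiveMacaulayfication.S2ModificationAffineSpec

end
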